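import Literature.Analysis.FluidPDE.NSBoundedHigherRegularityOfLemma61

/-!
# Converse bookkeeping for the crux `SelfMixingDichotomy.SequentialTypeIExclusion` (line `registered`)

Crux item `stmt-NavierStokesRegularity-1424`, route `SelfMixingDichotomy`, line `registered` (skeleton
`Cruxes/SequentialTypeIExclusion/Lines/birth.lean`, reshape r1). The skeleton reduces the crux
(`liminf_{r→0} C(r; T, x₀) ≤ M ⇒ u` bounded near `(T, x₀)`) to a Type-I bound on the cubic functional
`C(r) = r⁻² ∬_{Q_r(T,x₀)} |u|³` (`Literature.Analysis.FluidPDE.cknC`) plus windows of arbitrary depth. This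
file records the (elementary) CONVERSE direction, valid for an arbitrary field `u`: if `u` is bounded on a
backward cylinder `(T − ρ², T) × B_ρ(x₀)` then `C(r; T, x₀) ≤ |B₁| M³ r³` for `r ≤ ρ`, hence `C(r) → 0`,
so both the Type-I bound (conclusion of `stub_windowsForceTypeI`) and the deep windows (conclusion of
`stub_typeIWindowsDeepen`) hold at every point of local boundedness. Together with stub 1 (r1) this shows
the line's reduction is tight: the crux is EQUIVALENT to "Type-I windows at arbitrarily small scales force
`C(r) → 0`".

Contents (namespace `Summit.NavierStokesRegularity.NavierStokesRegularity.Theorems.SequentialTypeIExclusion.Registered`):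
* `cknC_le_of_bdd` — `C(r; T, x₀) ≤ ofReal (M³ r³) |B₁|` for `0 < r ≤ ρ` under a pointwise bound `M` on the
  cylinder of radius `ρ`;
* `tendsto_cknC_zero_of_bdd` — hence `C(r; T, x₀) → 0` as `r → 0⁺`;
* `cknC_typeIBound_of_bdd`, `cknC_windows_of_bdd` — the two stub conclusions at a point of boundedness.

Tree tools used: `Literature.Analysis.FluidPDE.cknC_le_of_ae_bound_subset`
(`NSBoundedHigherRegularityOfLemma61.lean`), `mem_parabolicCylinder`.
-/

noncomputable section

open Set MeasureTheory Filter Topology Metric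
open scoped ENNReal

namespace Summit.NavierStokesRegularity.NavierStokesRegularity.Theorems.SequentialTypeIExclusion.Registered

-- the summit-side namespace `Summit.NavierStokesRegularity.NavierStokesRegularity.…` (Problem = Summit)
-- duplicates a component by design (lakefile sets the same option for the library build)
set_option linter.dupNamespace false

open Literature.Analysis.FluidPDE

variable {T : ℝ} {u : ℝ → EuclideanSpace ℝ (Fin 3) → EuclideanSpace ℝ (Fin 3)}
  {x₀ : EuclideanSpace ℝ (Fin 3)} {ρ M : ℝ}

/-- **The cubic functional of a locally bounded field**: if `‖u t x‖ ≤ M` for `t ∈ (T − ρ², T)`,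
`x ∈ B_ρ(x₀)`, then `C(r; T, x₀) ≤ M³ r³ |B₁|` (as `ofReal (M³ r³) · |B₁|`) for every `0 < r ≤ ρ`
(`|Q_r| = r⁵ |B₁|`; the tree's `cknC_le_of_ae_bound_subset`). -/
theorem cknC_le_of_bdd (hM : 0 ≤ M)
    (hB : ∀ t ∈ Ioo (T - ρ ^ 2) T, ∀ x ∈ ball x₀ ρ, ‖u t x‖ ≤ M) {r : ℝ} (hr : 0 < r)
    (hrρ : r ≤ ρ) :
    cknC r ((T, x₀) : ℝ × EuclideanSpace ℝ (Fin 3)) u ≤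
      ENNReal.ofReal (M ^ 3 * r ^ 3) * volume (ball (0 : EuclideanSpace ℝ (Fin 3)) 1) := by
  -- the pointwise bound on the cylinder of radius `ρ`, as an a.e. bound on that set
  have hsub : parabolicCylinder r ((T, x₀) : ℝ × EuclideanSpace ℝ (Fin 3)) ⊆
      parabolicCylinder ρ ((T, x₀) : ℝ × EuclideanSpace ℝ (Fin 3)) := by
    refine prod_mono (Ioo_subset_Ioo ?_ le_rfl) (ball_subset_ball hrρ)
    dsimp only
    nlinarith [pow_le_pow_left₀ hr.le hrρ 2]
  have hbd : ∀ᵐ w ∂(volume.restrict (parabolicCylinder ρ ((T, x₀) : ℝ × EuclideanSpace ℝ (Fin 3)))),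
      ‖u w.1 w.2‖ ≤ M := by
    rw [ae_restrict_iff' (isOpen_parabolicCylinder ρ _).measurableSet]
    refine ae_of_all _ fun w hw => ?_
    rw [mem_parabolicCylinder] at hw
    exact hB w.1 ⟨hw.1.1, hw.1.2⟩ w.2 (mem_ball.2 hw.2)
  exact cknC_le_of_ae_bound_subset hM hbd hr hsub

/-- **`C(r; T, x₀) → 0` as `r → 0⁺` at a point of local boundedness** (from `cknC_le_of_bdd`:
`C(r) ≤ |B₁| M³ r³`). -/
theorem tendsto_cknC_zero_of_bdd (hρ : 0 < ρ)
    (hB : ∀ t ∈ Ioo (T - ρ ^ 2) T, ∀ x ∈ ball x₀ ρ, ‖u t x‖ ≤ M) :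
    Tendsto (fun r => cknC r ((T, x₀) : ℝ × EuclideanSpace ℝ (Fin 3)) u) (𝓝[>] 0) (𝓝 0) := by
  -- replace `M` by `max M 0 ≥ 0`
  have hB' : ∀ t ∈ Ioo (T - ρ ^ 2) T, ∀ x ∈ ball x₀ ρ, ‖u t x‖ ≤ max M 0 :=
    fun t ht x hx => (hB t ht x hx).trans (le_max_left _ _)
  set K : ℝ≥0∞ := volume (ball (0 : EuclideanSpace ℝ (Fin 3)) 1) with hK
  -- the majorant `ofReal ((max M 0)³ r³) · |B₁|` tends to `0`
  have hmaj : Tendsto (fun r : ℝ => ENNReal.ofReal ((max M 0) ^ 3 * r ^ 3) * K) (𝓝[>] 0) (𝓝 0) := by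
    have h1 : Tendsto (fun r : ℝ => (max M 0) ^ 3 * r ^ 3) (𝓝 (0 : ℝ)) (𝓝 ((max M 0) ^ 3 * 0 ^ 3)) :=
      ((continuous_const.mul (continuous_pow 3)).tendsto 0)
    rw [zero_pow three_ne_zero, mul_zero] at h1
    have h2 : Tendsto (fun r : ℝ => ENNReal.ofReal ((max M 0) ^ 3 * r ^ 3)) (𝓝 (0 : ℝ)) (𝓝 0) := by
      rw [← ENNReal.ofReal_zero]
      exact ENNReal.tendsto_ofReal h1
    have h3 : Tendsto (fun r : ℝ => ENNReal.ofReal ((max M 0) ^ 3 * r ^ 3) * K) (𝓝 (0 : ℝ)) (𝓝 (0 * K)) :=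
      ENNReal.Tendsto.mul_const h2 (Or.inr measure_ball_lt_top.ne)
    rw [zero_mul] at h3
    exact h3.mono_left nhdsWithin_le_nhds
  -- eventually `0 < r ≤ ρ` along `𝓝[>] 0`
  have hev : ∀ᶠ r in 𝓝[>] (0 : ℝ), 0 < r ∧ r ≤ ρ := by
    have h1 : ∀ᶠ r in 𝓝[>] (0 : ℝ), r ∈ Ioo 0 ρ := Ioo_mem_nhdsGT hρ
    exact h1.mono fun r hr => ⟨hr.1, hr.2.le⟩
  refine tendsto_of_tendsto_of_tendsto_of_le_of_le' tendsto_const_nhds hmaj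
    (Eventually.of_forall fun r => zero_le) ?_
  filter_upwards [hev] with r hr
  exact cknC_le_of_bdd (le_max_right _ _) hB' hr.1 hr.2

/-- **The centred cubic Type-I bound at a point of local boundedness** (conclusion of
`stub_windowsForceTypeI` there): `C(r; T, x₀) ≤ M³ ρ³ |B₁|` for all `0 < r < ρ`. -/
theorem cknC_typeIBound_of_bdd (hρ : 0 < ρ)
    (hB : ∀ t ∈ Ioo (T - ρ ^ 2) T, ∀ x ∈ ball x₀ ρ, ‖u t x‖ ≤ M) :
    ∃ M' : ℝ, ∃ r₁ : ℝ, 0 < r₁ ∧ ∀ r ∈ Ioo 0 r₁,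
      cknC r ((T, x₀) : ℝ × EuclideanSpace ℝ (Fin 3)) u ≤ ENNReal.ofReal M' := by
  have hB' : ∀ t ∈ Ioo (T - ρ ^ 2) T, ∀ x ∈ ball x₀ ρ, ‖u t x‖ ≤ max M 0 :=
    fun t ht x hx => (hB t ht x hx).trans (le_max_left _ _)
  set K : ℝ≥0∞ := volume (ball (0 : EuclideanSpace ℝ (Fin 3)) 1) with hK
  have hKtop : K ≠ ∞ := measure_ball_lt_top.ne
  refine ⟨(max M 0) ^ 3 * ρ ^ 3 * K.toReal, ρ, hρ, fun r hr => ?_⟩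
  calc cknC r ((T, x₀) : ℝ × EuclideanSpace ℝ (Fin 3)) u
      ≤ ENNReal.ofReal ((max M 0) ^ 3 * r ^ 3) * K := cknC_le_of_bdd (le_max_right _ _) hB' hr.1 hr.2.le
    _ ≤ ENNReal.ofReal ((max M 0) ^ 3 * ρ ^ 3) * K := by
        refine mul_le_mul_left (ENNReal.ofReal_le_ofReal ?_) K
        exact mul_le_mul_of_nonneg_left (pow_le_pow_left₀ hr.1.le hr.2.le 3)
          (pow_nonneg (le_max_right _ _) 3)
    _ = ENNReal.ofReal ((max M 0) ^ 3 * ρ ^ 3 * K.toReal) := by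
        rw [ENNReal.ofReal_mul' ENNReal.toReal_nonneg, ENNReal.ofReal_toReal hKtop]

/-- **Windows of every depth at a point of local boundedness** (conclusion of `stub_typeIWindowsDeepen`
there): for every `ε > 0` and `r₀ > 0` some `0 < r < r₀` has `C(r; T, x₀) ≤ ε`. -/
theorem cknC_windows_of_bdd (hρ : 0 < ρ)
    (hB : ∀ t ∈ Ioo (T - ρ ^ 2) T, ∀ x ∈ ball x₀ ρ, ‖u t x‖ ≤ M) {ε : ℝ} (hε : 0 < ε)
    {r₀ : ℝ} (hr₀ : 0 < r₀) :
    ∃ r ∈ Ioo 0 r₀, cknC r ((T, x₀) : ℝ × EuclideanSpace ℝ (Fin 3)) u ≤ ENNReal.ofReal ε := by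
  have hlim := tendsto_cknC_zero_of_bdd hρ hB
  -- eventually `C(r) ≤ ε` along `𝓝[>] 0`, and eventually `r ∈ (0, r₀)`
  have hev : ∀ᶠ r in 𝓝[>] (0 : ℝ), cknC r ((T, x₀) : ℝ × EuclideanSpace ℝ (Fin 3)) u ≤ ENNReal.ofReal ε :=
    (hlim.eventually (ge_mem_nhds (ENNReal.ofReal_pos.2 hε))).mono fun r hr => hr
  have hev' : ∀ᶠ r in 𝓝[>] (0 : ℝ), r ∈ Ioo 0 r₀ := Ioo_mem_nhdsGT hr₀
  obtain ⟨r, hr, hrI⟩ := (hev.and hev').exists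
  exact ⟨r, hrI, hr⟩

end Summit.NavierStokesRegularity.NavierStokesRegularity.Theorems.SequentialTypeIExclusion.Registered

end
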